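import Summits.Ventures.CertifiedManyBodySolver.Downfold.BoxesHg1201EStationKinematics
import Summits.Ventures.CertifiedManyBodySolver.Observables.StiffnessApexTransportCurtainTargetSlot
import HarnessLib

/-!
# Ventures/CertifiedManyBodySolver — Observables/RungLeavesCoverageHg1201PatchL.lean

THE CLOSER OF RECORD for the residual patch of the HgBa₂CuO₄₊δ «Hg-1201» rung leaf «MOS2-hg1201-M19b» in the captain's «L» shape
(hubbard-cov-hg1201-plan-1 CAPTAIN LINE 2026-08-28T05:53:44Z (3) + ADDENDUM v0.1 (A), HG1201-COVERAGE-PLAN v0.1 §3.2/§6; hubbard-obs RULINGS (nnn) d310 /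
(ooo) d311): residual patch `R = t′ ∈ [−27/50, −13/25] × U ∈ [7/2, 44/5] × n ∈ [87/100, 183/200]` (hubbard-cov-hg1201-box-2 `Downfold/BoxesHg1201EKinematicCover`,
`Hg1201M19b_StiffnessBoxCeiling_of_cornerPatch`), edition «L», NO OVERHANG, CORNER-OBJECTIVE READS ONLY:

* **S1 = K1 «PatchLeftEdge»**: per density `x ∈ [87/100, 183/200]`, for every station `U′ ∈ [7/2, 44/5]` an unconditional orbit-lower value `vL x U′` for the
  CORNER objective `−X₀(−27/50, U′)` on the torus-limit ground-state class at the LEFT-EDGE source `(t′, U, n) = (−27/50, U′, x)` (own slot — the vertex words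
  `w(7/2), w(5), w(44/5)` of hubbard-cov-hg1201-sdp-2 plus the `U`-segment device between vertices), with `−vL x U′ ≤ c`;
* **S2 = K2 «PatchBottom»**: per density, for every source `s ∈ [−27/50, −13/25]` an orbit-lower value `vB x s` for the SAME corner objective `−X₀(−27/50, 7/2)`
  on the class at `(s, 7/2, x)` (the short bottom `t′`-bundle at the station `U_A = 7/2`: corner parent + the `(7/2, ·, −13/25)` parent), with `−vB x s ≤ c`;
* the INNER-END reads `−X₀(−13/25, ·)` that the target-slot «L» (`ObsStiffnessSeqCeilingAt_on_box_of_bottomEdge_and_leftEdge_targetSlot`, hubbard-downfold-unc-2)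
  also wants are DISCHARGED HERE KINEMATICALLY by box-2's `orbitMean_neg_oddMomentTT_lam_zero_ge_kinematic_of_gs` on the chord row `halfBathtub_m13o25_chordLevel_le`
  (reading `(43731/90112)·x/2 + 0.2931906… ≤ 0.5152137` at `x ≤ 183/200`, any source Hamiltonian), and the `σ`-chord of the two END objectives
  (`orbitLower_slot_chord_of_two_endObjectives`) is the target-slot family — so the producers owe ONLY the corner-objective words.

Results (all proved, zero solve, no definition, no claim node, no `sorry`):
* §1 `hg1201_innerKinematicReading_le` (the inner-END kinematic value is `≤ 5152137/10⁷` on the patch densities) and the chord-price algebra;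
* §2 `hg1201M19b_patchWord_of_L_cornerObjective` — per density `n ∈ [87/100, 183/200]`, S1 + S2 with `−v ≤ c` and `5152137/10⁷ ≤ c` ⇒ the PATCH WORD
  `∀ t′ ∈ [−27/50, −13/25], ∀ U ∈ [7/2, 44/5], ObsStiffnessSeqCeilingAt t′ U n c`;
* §3 **`Hg1201M19b_StiffnessBoxCeiling_of_patchL_cornerObjective`** — S1 + S2 on `x ∈ [87/100, 183/200]` with `−v ≤ 5166800/10⁷` ⇒ the rung leaf
  `Hg1201M19b_StiffnessBoxCeiling` (word at the bar; kinematic cover elsewhere by `…_of_cornerPatch`); and the variant with an explicit word `c ∈ [5152137/10⁷, 5166800/10⁷]`;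
* §4 the crux-shaped corollaries: the PEN-draft bodies `LowUSlabCeiling` / `HighUSlabCeiling` (verbatim `∀ tp ∈ [−27/50, −43/100], ∀ U ∈ slab, ∀ n ∈ [167/200, 183/200],
  ObsStiffnessSeqCeilingAt tp U n (5166800/10⁷)`) from S1 restricted to the slab + S2 (the bottom family serves both slabs: its station `7/2` is the box bottom).
* §5 literals.

HONEST FRAMING: wording class (xx1) — certified stiffness CEILINGS on a downfolded box = CONTROL / CALIBRATION + labelled heuristic; «content» = below `0.98 ×` the
kinematic MAJORANT word of the box (`0.5272245`); the free-fermion value at the binding corner is lower still (`≈ 0.445` [float]) — NO suppression below free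
fermions is claimed (RULING (nnn) ERRATUM, interim bar rule); a ceiling never speaks to the presence of superconductivity; never «certified true negative /
positive»; not a `T_c` or phase sentence; nothing here is a statement about HgBa₂CuO₄₊δ; NO rung leaf is proved here — every leaf theorem is CONDITIONAL on the
S1/S2 families, which no certificate supplies yet (hubbard-cov-hg1201-sdp-2 corner legs and sdp-1 CAL-HG-A in flight, 2026-08-28).

Cell `pub/hubbard-obs` (LADDER-HUBBARD MO-S2, D-0154 (1)(C) Hg-1201), seat `hubbard-cov-hg1201-box-1` (`prover-hubbard-cov-hg1201-box-1-0`; work split of record: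
box-1 = windows / caps / node shapes / one-`exact` closers on R). Companions: `Observables/RungLeavesCoverageHg1201Strips.lean` (this seat; its
`…_of_bottomEdge_and_leftEdge_targetSlot_outerStrip` is the `q = −501/1000`, `n ≥ 167/200` edition with BOTH END reads owed — superseded for production by §3 here),
`Downfold/BoxesHg1201EKinematicCover.lean` + `Downfold/BoxesHg1201EStationKinematics.lean` (box-2), `Observables/StiffnessApexTransportCurtainTargetSlot.lean` (unc-2).

References: T. Koma, H. Tasaki, J. Stat. Phys. 76 (1994) 745, §1 [KomaTasaki1994]; D. J. Scalapino, S. R. White, S.-C. Zhang, PRB 47 (1993) 7995, §II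
[ScalapinoWhiteZhang1993]; T. Hazra, N. Verma, M. Randeria, PRX 9 (2019) 031049, eqs. (2)–(6) [HazraVermaRanderia2019]; E. H. Lieb, M. Loss, Duke Math. J. 71
(1993) 337, §8 Thm. 8.2 [LiebLoss1993].
-/

noncomputable section

namespace Summit.Ventures.CertifiedManyBodySolver.Observables

open Real Set NonemptyInterval Filter Topology
open Summit.Ventures.CertifiedManyBodySolver.Downfold
open Summit.Ventures.CertifiedManyBodySolver.Certificates
open Literature.MathematicalPhysics.QuantumLattice Literature.MathematicalPhysics.QuantumLattice.ThermodynamicLimit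
open Literature.Probability.LatticeModels
open Matrix HubbardWave0
open scoped BigOperators ComplexOrder

/-! ## §1 The inner-END kinematic reading and the chord-price algebra -/

/-- The inner-END kinematic reading at the patch densities: `(43731/90112)·x/2 + ((9/11)·0.3123804228 + (2/11)·0.2068368242) ≤ 5152137/10⁷` for `x ≤ 183/200`
(value `0.51521363…` at the top; box-2's chord row at `t′ = −13/25`). [cite: HazraVermaRanderia2019, eqs. (2)-(6)] -/
theorem hg1201_innerKinematicReading_le {x : ℝ} (hx : x ≤ 183 / 200) :
    (43731 / 90112 : ℝ) * x / 2 + ((9 / 11 : ℝ) * 0.3123804228 + 2 / 11 * 0.2068368242) ≤ (((5152137 / 10000000 : ℚ)) : ℝ) := by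
  push_cast
  norm_num at hx ⊢
  linarith

/-- Chord-price algebra: with convex weights `a, b ≥ 0`, `a + b = 1`, `−vP ≤ c` and `−vQ ≤ c` give `−(a·vP + b·vQ) ≤ c`. [folklore] -/
theorem neg_convexComb_le_of_neg_le {a b vP vQ c : ℝ} (ha : 0 ≤ a) (hb : 0 ≤ b) (hab : a + b = 1) (hP : -vP ≤ c) (hQ : -vQ ≤ c) :
    -(a * vP + b * vQ) ≤ c := by
  have h1 : a * (-vP) ≤ a * c := mul_le_mul_of_nonneg_left hP ha
  have h2 : b * (-vQ) ≤ b * c := mul_le_mul_of_nonneg_left hQ hb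
  have h3 : a * c + b * c = c := by rw [← add_mul, hab, one_mul]
  rw [mul_neg] at h1 h2
  linarith

/-- The `σ`-chord weights on `[−27/50, −13/25]`: for `σ ∈ [−27/50, −13/25]`, `(−13/25 − σ)/(1/50) ≥ 0`, `(σ + 27/50)/(1/50) ≥ 0`, summing to `1`. [folklore] -/
theorem hg1201_patch_slotWeights {σ : ℝ} (hσ : σ ∈ Icc (-27 / 50 : ℝ) (-13 / 25)) :
    0 ≤ (-13 / 25 - σ) / (-13 / 25 - -27 / 50) ∧ 0 ≤ (σ - -27 / 50) / (-13 / 25 - -27 / 50) ∧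
      (-13 / 25 - σ) / (-13 / 25 - -27 / 50) + (σ - -27 / 50) / (-13 / 25 - -27 / 50) = 1 := by
  refine ⟨div_nonneg (by linarith [hσ.2]) (by norm_num), div_nonneg (by linarith [hσ.1]) (by norm_num), ?_⟩
  rw [← add_div]
  have h : (-13 / 25 - σ) + (σ - -27 / 50) = (-13 / 25 - -27 / 50 : ℝ) := by ring
  rw [h]
  exact div_self (by norm_num)

/-! ## §2 The PATCH WORD per density from S1 (left edge) + S2 (short bottom), corner-objective reads only -/

/-- **PATCH WORD from the «L», corner-objective reads only** (density `0 ≤ n ≤ 183/200`, `n < 2` automatic). S1: for every `U′ ∈ [7/2, 44/5]` an orbit-lower value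
`vL U′` for `−X₀(−27/50, U′)` on the class at `(−27/50, U′, n)`; S2: for every `s ∈ [−27/50, −13/25]` an orbit-lower value `vB s` for `−X₀(−27/50, 7/2)` on the class at
`(s, 7/2, n)`; prices `−vL ≤ c`, `−vB ≤ c`, and `5152137/10⁷ ≤ c` (so the kinematic inner-END reads are `≤ c` too). Then `ObsStiffnessSeqCeilingAt t′ U n c` on the
whole patch `[−27/50, −13/25] × [7/2, 44/5]` at density `n` — the target-slot families of the «L» theorem are the `σ`-chords of (corner read, kinematic inner read).
[cite: KomaTasaki1994, §1] [cite: ScalapinoWhiteZhang1993, §II] [cite: LiebLoss1993, §8, Theorem 8.2] -/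
theorem hg1201M19b_patchWord_of_L_cornerObjective {n : ℝ} (hn0 : 0 ≤ n) (hn : n ≤ 183 / 200) (vL vB : ℝ → ℝ) (c : ℚ)
    (hkin : (5152137 / 10000000 : ℚ) ≤ c)
    (hL : ∀ U' ∈ Set.Icc (7 / 2 : ℝ) (44 / 5),
      ∀ (ω : InfVolFermionState 2) (Ls : ℕ → ℕ) (ψ : ∀ L, Fock (Orb (FermionTorus 2 L))),
      Tendsto Ls atTop atTop →
      (∀ j, IsGroundStateInSector (hubbardTorusTT' (Ls j) 1 (-27 / 50) U') (rectN n (Ls j)) 0 (ψ (Ls j))) →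
      (∀ j, star (ψ (Ls j)) ⬝ᵥ ψ (Ls j) = 1) → ω.IsTorusLimitOf ψ Ls →
      vL U' ≤ ((Finset.univ : Finset (DihedralGroup 4)).card : ℝ)⁻¹ * ∑ g ∈ (Finset.univ : Finset (DihedralGroup 4)),
        (ω.expect (d4ShiftSet g 0 (box 2 7)) (fermionEmbed (PolySite.d4Emb g 0 (box 2 7)) (-oddMomentObsTT (-27 / 50) U' 0))).re)
    (hcL : ∀ U' ∈ Set.Icc (7 / 2 : ℝ) (44 / 5), -vL U' ≤ ((c : ℚ) : ℝ))
    (hB : ∀ s ∈ Set.Icc (-27 / 50 : ℝ) (-13 / 25),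
      ∀ (ω : InfVolFermionState 2) (Ls : ℕ → ℕ) (ψ : ∀ L, Fock (Orb (FermionTorus 2 L))),
      Tendsto Ls atTop atTop →
      (∀ j, IsGroundStateInSector (hubbardTorusTT' (Ls j) 1 s (7 / 2)) (rectN n (Ls j)) 0 (ψ (Ls j))) →
      (∀ j, star (ψ (Ls j)) ⬝ᵥ ψ (Ls j) = 1) → ω.IsTorusLimitOf ψ Ls →
      vB s ≤ ((Finset.univ : Finset (DihedralGroup 4)).card : ℝ)⁻¹ * ∑ g ∈ (Finset.univ : Finset (DihedralGroup 4)),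
        (ω.expect (d4ShiftSet g 0 (box 2 7)) (fermionEmbed (PolySite.d4Emb g 0 (box 2 7)) (-oddMomentObsTT (-27 / 50) (7 / 2) 0))).re)
    (hcB : ∀ s ∈ Set.Icc (-27 / 50 : ℝ) (-13 / 25), -vB s ≤ ((c : ℚ) : ℝ)) :
    ∀ tp ∈ Set.Icc (-27 / 50 : ℝ) (-13 / 25), ∀ U ∈ Set.Icc (7 / 2 : ℝ) (44 / 5), ObsStiffnessSeqCeilingAt tp U n c := by
  have hn2 : n < 2 := by linarith
  -- the kinematic inner-END value at this density (positive number `KQ`; the orbit-lower read is `−KQ`)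
  set KQ : ℝ := (43731 / 90112 : ℝ) * n / 2 + ((9 / 11 : ℝ) * 0.3123804228 + 2 / 11 * 0.2068368242) with hKQ
  have hKQc : -(-KQ) ≤ ((c : ℚ) : ℝ) := by
    rw [neg_neg]
    exact (hg1201_innerKinematicReading_le hn).trans (by exact_mod_cast hkin)
  refine ObsStiffnessSeqCeilingAt_on_box_of_bottomEdge_and_leftEdge_targetSlot (p := -27 / 50) (q := -13 / 25) (UA := 7 / 2)
    (Umax := 44 / 5) (n := n) (by norm_num) (by norm_num) (by norm_num) hn0 hn2
    (fun σ s => (-13 / 25 - σ) / (-13 / 25 - -27 / 50) * vB s + (σ - -27 / 50) / (-13 / 25 - -27 / 50) * (-KQ))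
    (fun σ U' => (-13 / 25 - σ) / (-13 / 25 - -27 / 50) * vL U' + (σ - -27 / 50) / (-13 / 25 - -27 / 50) * (-KQ)) c
    (fun σ hσ s hs ω Ls ψ hLs hψ h1 hω => ?_) (fun σ hσ s hs => ?_) (fun σ hσ U' hU' ω Ls ψ hLs hψ h1 hω => ?_)
    (fun σ hσ U' hU' => ?_)
  · -- S2 bottom: σ-chord of the corner read at `(s, 7/2)` and the kinematic inner read
    have hsI : s ∈ Set.Icc (-27 / 50 : ℝ) (-13 / 25) := ⟨hs.1, hs.2.trans hσ.2⟩
    exact orbitLower_slot_chord_of_two_endObjectives hω.isTranslationInvariant (7 / 2) (by norm_num) hσ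
      (hB s hsI ω Ls ψ hLs hψ h1 hω)
      (orbitMean_neg_oddMomentTT_lam_zero_ge_kinematic_of_gs (-13 / 25) (7 / 2) s (7 / 2) halfBathtub_m13o25_chordLevel_le
        hn0 hn2 ω Ls ψ hLs hψ h1 hω)
  · obtain ⟨ha, hb, hab⟩ := hg1201_patch_slotWeights hσ
    exact neg_convexComb_le_of_neg_le ha hb hab (hcB s ⟨hs.1, hs.2.trans hσ.2⟩) hKQc
  · -- S1 left edge: σ-chord of the corner read at `(−27/50, U′)` and the kinematic inner read
    exact orbitLower_slot_chord_of_two_endObjectives hω.isTranslationInvariant U' (by norm_num) hσ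
      (hL U' hU' ω Ls ψ hLs hψ h1 hω)
      (orbitMean_neg_oddMomentTT_lam_zero_ge_kinematic_of_gs (-13 / 25) U' (-27 / 50) U' halfBathtub_m13o25_chordLevel_le
        hn0 hn2 ω Ls ψ hLs hψ h1 hω)
  · obtain ⟨ha, hb, hab⟩ := hg1201_patch_slotWeights hσ
    exact neg_convexComb_le_of_neg_le ha hb hab (hcL U' hU') hKQc

/-! ## §3 THE RUNG LEAF «MOS2-hg1201-M19b» from S1 + S2 on the patch densities (the closer OF RECORD, captain (3)/(A)) -/

/-- **`Hg1201M19b_StiffnessBoxCeiling` FROM THE «L» ON THE RESIDUAL PATCH, CORNER-OBJECTIVE READS ONLY, explicit word `c`.** Per density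
`x ∈ [87/100, 183/200]`: S1 = K1 «PatchLeftEdge» (`vL x U′`, `U′ ∈ [7/2, 44/5]`, objective `−X₀(−27/50, U′)`, class at `(−27/50, U′, x)`) and S2 = K2 «PatchBottom»
(`vB x s`, `s ∈ [−27/50, −13/25]`, objective `−X₀(−27/50, 7/2)`, class at `(s, 7/2, x)`), with `−vL ≤ c`, `−vB ≤ c`, `5152137/10⁷ ≤ c ≤ 5166800/10⁷` ⇒ the rung leaf
(patch word by §2, kinematic cover elsewhere by `Hg1201M19b_StiffnessBoxCeiling_of_cornerPatch`). [cite: KomaTasaki1994, §1] [cite: ScalapinoWhiteZhang1993, §II] -/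
theorem Hg1201M19b_StiffnessBoxCeiling_of_patchL_cornerObjective_word (vL vB : ℝ → ℝ → ℝ) (c : ℚ)
    (hkin : (5152137 / 10000000 : ℚ) ≤ c) (hbar : c ≤ 5166800 / 10000000)
    (hL : ∀ x ∈ Set.Icc (87 / 100 : ℝ) (183 / 200), ∀ U' ∈ Set.Icc (7 / 2 : ℝ) (44 / 5),
      ∀ (ω : InfVolFermionState 2) (Ls : ℕ → ℕ) (ψ : ∀ L, Fock (Orb (FermionTorus 2 L))),
      Tendsto Ls atTop atTop →
      (∀ j, IsGroundStateInSector (hubbardTorusTT' (Ls j) 1 (-27 / 50) U') (rectN x (Ls j)) 0 (ψ (Ls j))) →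
      (∀ j, star (ψ (Ls j)) ⬝ᵥ ψ (Ls j) = 1) → ω.IsTorusLimitOf ψ Ls →
      vL x U' ≤ ((Finset.univ : Finset (DihedralGroup 4)).card : ℝ)⁻¹ * ∑ g ∈ (Finset.univ : Finset (DihedralGroup 4)),
        (ω.expect (d4ShiftSet g 0 (box 2 7)) (fermionEmbed (PolySite.d4Emb g 0 (box 2 7)) (-oddMomentObsTT (-27 / 50) U' 0))).re)
    (hcL : ∀ x ∈ Set.Icc (87 / 100 : ℝ) (183 / 200), ∀ U' ∈ Set.Icc (7 / 2 : ℝ) (44 / 5), -vL x U' ≤ ((c : ℚ) : ℝ))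
    (hB : ∀ x ∈ Set.Icc (87 / 100 : ℝ) (183 / 200), ∀ s ∈ Set.Icc (-27 / 50 : ℝ) (-13 / 25),
      ∀ (ω : InfVolFermionState 2) (Ls : ℕ → ℕ) (ψ : ∀ L, Fock (Orb (FermionTorus 2 L))),
      Tendsto Ls atTop atTop →
      (∀ j, IsGroundStateInSector (hubbardTorusTT' (Ls j) 1 s (7 / 2)) (rectN x (Ls j)) 0 (ψ (Ls j))) →
      (∀ j, star (ψ (Ls j)) ⬝ᵥ ψ (Ls j) = 1) → ω.IsTorusLimitOf ψ Ls →
      vB x s ≤ ((Finset.univ : Finset (DihedralGroup 4)).card : ℝ)⁻¹ * ∑ g ∈ (Finset.univ : Finset (DihedralGroup 4)),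
        (ω.expect (d4ShiftSet g 0 (box 2 7)) (fermionEmbed (PolySite.d4Emb g 0 (box 2 7)) (-oddMomentObsTT (-27 / 50) (7 / 2) 0))).re)
    (hcB : ∀ x ∈ Set.Icc (87 / 100 : ℝ) (183 / 200), ∀ s ∈ Set.Icc (-27 / 50 : ℝ) (-13 / 25), -vB x s ≤ ((c : ℚ) : ℝ)) :
    Hg1201M19b_StiffnessBoxCeiling :=
  Hg1201M19b_StiffnessBoxCeiling_of_cornerPatch hbar fun tp htp U hU n hn =>
    hg1201M19b_patchWord_of_L_cornerObjective (by linarith [hn.1]) hn.2 (vL n) (vB n) c hkin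
      (hL n hn) (hcL n hn) (hB n hn) (hcB n hn) tp htp U hU

/-- **THE CLOSER OF RECORD (word at the bar).** S1 + S2 as above with `−vL ≤ 5166800/10⁷`, `−vB ≤ 5166800/10⁷` on `x ∈ [87/100, 183/200]` ⇒
`Hg1201M19b_StiffnessBoxCeiling`. The producers owe exactly: the LEFT-EDGE corner-objective family (sdp-2's `w(U′)` vertex words + the `U`-segment device) and the
SHORT-BOTTOM corner-objective family at `U_A = 7/2` over `s ∈ [−27/50, −13/25]` (sdp-1 / gen-1), each read density-affinely on `[87/100, 183/200]`; nothing at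
`t′ < −27/50`, no inner-objective solve, no `K₂` input. [cite: KomaTasaki1994, §1] [cite: ScalapinoWhiteZhang1993, §II] -/
theorem Hg1201M19b_StiffnessBoxCeiling_of_patchL_cornerObjective (vL vB : ℝ → ℝ → ℝ)
    (hL : ∀ x ∈ Set.Icc (87 / 100 : ℝ) (183 / 200), ∀ U' ∈ Set.Icc (7 / 2 : ℝ) (44 / 5),
      ∀ (ω : InfVolFermionState 2) (Ls : ℕ → ℕ) (ψ : ∀ L, Fock (Orb (FermionTorus 2 L))),
      Tendsto Ls atTop atTop →
      (∀ j, IsGroundStateInSector (hubbardTorusTT' (Ls j) 1 (-27 / 50) U') (rectN x (Ls j)) 0 (ψ (Ls j))) →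
      (∀ j, star (ψ (Ls j)) ⬝ᵥ ψ (Ls j) = 1) → ω.IsTorusLimitOf ψ Ls →
      vL x U' ≤ ((Finset.univ : Finset (DihedralGroup 4)).card : ℝ)⁻¹ * ∑ g ∈ (Finset.univ : Finset (DihedralGroup 4)),
        (ω.expect (d4ShiftSet g 0 (box 2 7)) (fermionEmbed (PolySite.d4Emb g 0 (box 2 7)) (-oddMomentObsTT (-27 / 50) U' 0))).re)
    (hcL : ∀ x ∈ Set.Icc (87 / 100 : ℝ) (183 / 200), ∀ U' ∈ Set.Icc (7 / 2 : ℝ) (44 / 5), -vL x U' ≤ (5166800 / 10000000 : ℝ))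
    (hB : ∀ x ∈ Set.Icc (87 / 100 : ℝ) (183 / 200), ∀ s ∈ Set.Icc (-27 / 50 : ℝ) (-13 / 25),
      ∀ (ω : InfVolFermionState 2) (Ls : ℕ → ℕ) (ψ : ∀ L, Fock (Orb (FermionTorus 2 L))),
      Tendsto Ls atTop atTop →
      (∀ j, IsGroundStateInSector (hubbardTorusTT' (Ls j) 1 s (7 / 2)) (rectN x (Ls j)) 0 (ψ (Ls j))) →
      (∀ j, star (ψ (Ls j)) ⬝ᵥ ψ (Ls j) = 1) → ω.IsTorusLimitOf ψ Ls →
      vB x s ≤ ((Finset.univ : Finset (DihedralGroup 4)).card : ℝ)⁻¹ * ∑ g ∈ (Finset.univ : Finset (DihedralGroup 4)),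
        (ω.expect (d4ShiftSet g 0 (box 2 7)) (fermionEmbed (PolySite.d4Emb g 0 (box 2 7)) (-oddMomentObsTT (-27 / 50) (7 / 2) 0))).re)
    (hcB : ∀ x ∈ Set.Icc (87 / 100 : ℝ) (183 / 200), ∀ s ∈ Set.Icc (-27 / 50 : ℝ) (-13 / 25), -vB x s ≤ (5166800 / 10000000 : ℝ)) :
    Hg1201M19b_StiffnessBoxCeiling := by
  have hc : (((5166800 / 10000000 : ℚ)) : ℝ) = (5166800 / 10000000 : ℝ) := by push_cast; norm_num
  exact Hg1201M19b_StiffnessBoxCeiling_of_patchL_cornerObjective_word vL vB (5166800 / 10000000) (by norm_num) le_rfl hL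
    (fun x hx U' hU' => by rw [hc]; exact hcL x hx U' hU') hB (fun x hx s hs => by rw [hc]; exact hcB x hx s hs)

/-! ## §4 The PEN-draft crux bodies from the same families (route «hubbard-cov-hg1201-1», items `LowUSlabCeiling` / `HighUSlabCeiling`) -/

/-- **A `U`-SLAB crux body, verbatim shape, from S1 restricted to the slab + S2.** For a slab `[Ulo, Uhi] ⊆ [7/2, 44/5]` with `Ulo = 7/2` (the bottom
family's station is the box bottom, so the «L» on `[−27/50, −13/25] × [7/2, Uhi]` is served by S2 and by S1 restricted to `U′ ≤ Uhi`):
`∀ tp ∈ [−27/50, −43/100], ∀ U ∈ [7/2, Uhi], ∀ n ∈ [167/200, 183/200], ObsStiffnessSeqCeilingAt tp U n (5166800/10⁷)` — i.e. the PEN's `LowUSlabCeiling` at `Uhi = 5`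
and the whole cell at `Uhi = 44/5` (kinematic cover outside the patch by box-2's `hg1201M19b_cell_of_cornerPatch`). [cite: KomaTasaki1994, §1] [cite: ScalapinoWhiteZhang1993, §II] -/
theorem hg1201M19b_slabFromBottom_of_patchL_cornerObjective {Uhi : ℝ} (hUhi : Uhi ∈ Set.Icc (7 / 2 : ℝ) (44 / 5))
    (vL vB : ℝ → ℝ → ℝ)
    (hL : ∀ x ∈ Set.Icc (87 / 100 : ℝ) (183 / 200), ∀ U' ∈ Set.Icc (7 / 2 : ℝ) Uhi,
      ∀ (ω : InfVolFermionState 2) (Ls : ℕ → ℕ) (ψ : ∀ L, Fock (Orb (FermionTorus 2 L))),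
      Tendsto Ls atTop atTop →
      (∀ j, IsGroundStateInSector (hubbardTorusTT' (Ls j) 1 (-27 / 50) U') (rectN x (Ls j)) 0 (ψ (Ls j))) →
      (∀ j, star (ψ (Ls j)) ⬝ᵥ ψ (Ls j) = 1) → ω.IsTorusLimitOf ψ Ls →
      vL x U' ≤ ((Finset.univ : Finset (DihedralGroup 4)).card : ℝ)⁻¹ * ∑ g ∈ (Finset.univ : Finset (DihedralGroup 4)),
        (ω.expect (d4ShiftSet g 0 (box 2 7)) (fermionEmbed (PolySite.d4Emb g 0 (box 2 7)) (-oddMomentObsTT (-27 / 50) U' 0))).re)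
    (hcL : ∀ x ∈ Set.Icc (87 / 100 : ℝ) (183 / 200), ∀ U' ∈ Set.Icc (7 / 2 : ℝ) Uhi, -vL x U' ≤ (5166800 / 10000000 : ℝ))
    (hB : ∀ x ∈ Set.Icc (87 / 100 : ℝ) (183 / 200), ∀ s ∈ Set.Icc (-27 / 50 : ℝ) (-13 / 25),
      ∀ (ω : InfVolFermionState 2) (Ls : ℕ → ℕ) (ψ : ∀ L, Fock (Orb (FermionTorus 2 L))),
      Tendsto Ls atTop atTop →
      (∀ j, IsGroundStateInSector (hubbardTorusTT' (Ls j) 1 s (7 / 2)) (rectN x (Ls j)) 0 (ψ (Ls j))) →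
      (∀ j, star (ψ (Ls j)) ⬝ᵥ ψ (Ls j) = 1) → ω.IsTorusLimitOf ψ Ls →
      vB x s ≤ ((Finset.univ : Finset (DihedralGroup 4)).card : ℝ)⁻¹ * ∑ g ∈ (Finset.univ : Finset (DihedralGroup 4)),
        (ω.expect (d4ShiftSet g 0 (box 2 7)) (fermionEmbed (PolySite.d4Emb g 0 (box 2 7)) (-oddMomentObsTT (-27 / 50) (7 / 2) 0))).re)
    (hcB : ∀ x ∈ Set.Icc (87 / 100 : ℝ) (183 / 200), ∀ s ∈ Set.Icc (-27 / 50 : ℝ) (-13 / 25), -vB x s ≤ (5166800 / 10000000 : ℝ)) :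
    ∀ tp ∈ Set.Icc (-27 / 50 : ℝ) (-43 / 100), ∀ U ∈ Set.Icc (7 / 2 : ℝ) Uhi, ∀ n ∈ Set.Icc (167 / 200 : ℝ) (183 / 200),
      ObsStiffnessSeqCeilingAt tp U n (5166800 / 10000000) := by
  have hc : (((5166800 / 10000000 : ℚ)) : ℝ) = (5166800 / 10000000 : ℝ) := by push_cast; norm_num
  refine hg1201M19b_cell_of_cornerPatch (Ulo := 7 / 2) (Uhi := Uhi) (c := 5166800 / 10000000) le_rfl fun tp htp U hU n hn => ?_
  have hn0 : 0 ≤ n := by linarith [hn.1]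
  have hn2 : n < 2 := by linarith [hn.2]
  set KQ : ℝ := (43731 / 90112 : ℝ) * n / 2 + ((9 / 11 : ℝ) * 0.3123804228 + 2 / 11 * 0.2068368242) with hKQ
  have hKQc : -(-KQ) ≤ (((5166800 / 10000000 : ℚ)) : ℝ) := by
    rw [neg_neg, hc]
    exact (hg1201_innerKinematicReading_le hn.2).trans (by norm_num)
  refine ObsStiffnessSeqCeilingAt_on_box_of_bottomEdge_and_leftEdge_targetSlot (p := -27 / 50) (q := -13 / 25) (UA := 7 / 2)
    (Umax := Uhi) (n := n) (by norm_num) hUhi.1 (by norm_num) hn0 hn2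
    (fun σ s => (-13 / 25 - σ) / (-13 / 25 - -27 / 50) * vB n s + (σ - -27 / 50) / (-13 / 25 - -27 / 50) * (-KQ))
    (fun σ U' => (-13 / 25 - σ) / (-13 / 25 - -27 / 50) * vL n U' + (σ - -27 / 50) / (-13 / 25 - -27 / 50) * (-KQ)) _
    (fun σ hσ s hs ω Ls ψ hLs hψ h1 hω => ?_) (fun σ hσ s hs => ?_) (fun σ hσ U' hU' ω Ls ψ hLs hψ h1 hω => ?_)
    (fun σ hσ U' hU' => ?_) tp htp U hU
  · have hsI : s ∈ Set.Icc (-27 / 50 : ℝ) (-13 / 25) := ⟨hs.1, hs.2.trans hσ.2⟩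
    exact orbitLower_slot_chord_of_two_endObjectives hω.isTranslationInvariant (7 / 2) (by norm_num) hσ
      (hB n hn s hsI ω Ls ψ hLs hψ h1 hω)
      (orbitMean_neg_oddMomentTT_lam_zero_ge_kinematic_of_gs (-13 / 25) (7 / 2) s (7 / 2) halfBathtub_m13o25_chordLevel_le
        hn0 hn2 ω Ls ψ hLs hψ h1 hω)
  · obtain ⟨ha, hb, hab⟩ := hg1201_patch_slotWeights hσ
    have hP : -vB n s ≤ (((5166800 / 10000000 : ℚ)) : ℝ) := by rw [hc]; exact hcB n hn s ⟨hs.1, hs.2.trans hσ.2⟩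
    exact neg_convexComb_le_of_neg_le ha hb hab hP hKQc
  · exact orbitLower_slot_chord_of_two_endObjectives hω.isTranslationInvariant U' (by norm_num) hσ
      (hL n hn U' hU' ω Ls ψ hLs hψ h1 hω)
      (orbitMean_neg_oddMomentTT_lam_zero_ge_kinematic_of_gs (-13 / 25) U' (-27 / 50) U' halfBathtub_m13o25_chordLevel_le
        hn0 hn2 ω Ls ψ hLs hψ h1 hω)
  · obtain ⟨ha, hb, hab⟩ := hg1201_patch_slotWeights hσ
    have hP : -vL n U' ≤ (((5166800 / 10000000 : ℚ)) : ℝ) := by rw [hc]; exact hcL n hn U' hU'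
    exact neg_convexComb_le_of_neg_le ha hb hab hP hKQc

/-! ## §5 Literals -/

/-- Literals (decidable): the patch geometry (`σ`-chord length `1/50`; the patch is `(1/50)/(11/100) × (9/200)/(2/25) = 9/88` of the `(t′, n)` face), the
inner kinematic reading at the top filling `(43731/90112)(183/200)/2 + (9/11)(0.3123804228) + (2/11)(0.2068368242) ≤ 0.5152137 < 0.5166800` (margin `≥ 0.0014663`), and
the word band this closer serves: `c ∈ [0.5152137, 0.5166800]` (below `0.5152137` the inner-END reads must be certified too — use unc-2's two-END edition). [folklore] -/
theorem hg1201_patchL_literals :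
    ((-13 / 25 : ℚ) - -27 / 50 = 1 / 50) ∧ ((1 / 50 : ℚ) / (11 / 100) * ((9 / 200) / (2 / 25)) = 9 / 88) ∧
    ((43731 / 90112 : ℚ) * (183 / 200) / 2 + ((9 / 11) * (3123804228 / 10000000000) + (2 / 11) * (2068368242 / 10000000000)) ≤
      5152137 / 10000000) ∧
    ((5166800 / 10000000 : ℚ) - 5152137 / 10000000 = 14663 / 10000000) ∧ ((5152137 / 10000000 : ℚ) < 5166800 / 10000000) := by
  norm_num

end Summit.Ventures.CertifiedManyBodySolver.Observables

end
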